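import Summits.CriticalPhenomena.PercolationContinuityZ3.Theorems.PercNearOneGluingNoHeavyLowerTailSahiMixtureHereditary

/-!
# Irredundant reduction: hereditary all-orders positivity (and every hereditary mixture statement) is decided by the rows whose index sets
# each keep a PRIVATE element — at most `n` slots for `n` events

Support file of the one-cut programme (crux `NoHeavyLowerTail`, stmt-CriticalPhenomena-4575; cell `prim-masterthm`, seat P3, gen 6;
`run/shared/lean/prim/prim-masterthm/prim-masterthm-p3/HIERARCHY.md` §13).  Generalises gen 5's RANGE LIFTING (`…SahiMixtureLaw.bernsteinPos_sahiE_of_injective`: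
repeated members are free) from "two equal slots" to "one slot CONTAINS the intersection of the others": in P5's defect expansion
(`SahiDefectExpansion.sahiE_cons_eq_defect_expansion`) the top defect `E[(1−d)·Π g_i]` vanishes as soon as the head event contains `⋂` of the tail events, and every
other term is a nonnegative combination of lower-order rows of sub-families.

* `bernsteinPos_sahiE_of_uncovered` — for ANY family of events `B : ι → Set (α × Bool)` on a coin space: if the mixture cells `h ↦ E_m(μ⊗coin(h); 1_{B∘s})` are
  Bernstein-positive for every slot map `s` in which NO slot contains the intersection of the others ("uncovered"), then they are for EVERY slot map.
* `sahiE_nonneg_of_uncovered` — the same at a fixed weight (no coin): nonnegativity of all rows from the uncovered rows.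
* For INTERSECTION-CLOSED families `B_K = ⋂_{i∈K} E_i` a slot map `K : Fin m → Finset (Fin n)` is uncovered only if it is IRREDUNDANT (`Irredundant K`: no `K a` inside
  the union of the other `K b`), and an irredundant `K` has `m ≤ n` (`Irredundant.card_le`, private elements are distinct).  Hence
  **`hereditaryAllOrders_of_irredundant`**: `𝒦`-membership of `n` events is decided by the irredundant rows of order `≤ n` (for `n = 4`: the singleton row `E_4(A)`,
  the triples `(A_{0∪D_0}, A_{1∪D_1}, A_{2∪D_2})`, `D_j ⊆ {3}`, up to symmetry, and covariances), and **`hereditaryMixture_of_irredundant`**: the hereditary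
  mixture statement (all rows of the ∩-closed family of the OR-mixed events, `@[conjecture] HereditaryMixturePositivity`) for `n` events follows from its
  irredundant cells, `m ≤ n` — a FINITE list (ttrl cp-mix's H-MIX censuses at "hereditary rows of order ≤ n" are therefore complete censuses).
HONEST FRAMING: reductions only; H-MIX itself stays open. [this work]
-/

noncomputable section

open scoped Classical

namespace Summit.CriticalPhenomena.PercolationContinuityZ3.Theorems

open Finset Function
open Literature.Combinatorics.Sahi2008
open Literature.Probability.Percolation.BHK2006 (ind_le_one)
open Literature.Probability.Percolation.DecisionTree (ind ind_of_mem ind_of_not_mem ind_nonneg)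
open SahiComb
open scoped Nat

namespace SahiMixture

/-! ### Uncovered slot maps -/

/-- A slot map is UNCOVERED for the family `B` if no slot's event contains the intersection of the other slots' events. [this work] -/
def Uncovered {ι β : Type*} (B : ι → Set β) {m : ℕ} (s : Fin m → ι) : Prop :=
  ∀ a : Fin m, ¬ ((⋂ b ∈ (univ : Finset (Fin m)).erase a, B (s b)) ⊆ B (s a))

section Coin

variable {α : Type*} [Fintype α] {ι : Type*}

/-- The top defect vanishes when the head event contains the intersection of the tail events. [this work] -/
theorem one_sub_ind_mul_prod_eq_zero {β : Type*} {k : ℕ} (D : Set β) (G : Fin (k + 1) → Set β) (hcov : (⋂ i, G i) ⊆ D) :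
    ((1 - ind D) * ∏ i, ind (G i)) = 0 := by
  funext x
  simp only [Pi.mul_apply, Pi.sub_apply, Pi.one_apply, Finset.prod_apply, Pi.zero_apply]
  by_cases hx : x ∈ D
  · simp [ind_of_mem hx]
  · have : ∃ i, x ∉ G i := by
      by_contra hall
      exact hx (hcov (Set.mem_iInter.2 fun i => by by_contra hi; exact hall ⟨i, hi⟩))
    obtain ⟨i, hi⟩ := this
    rw [Finset.prod_eq_zero (f := fun c => ind (G c) x) (Finset.mem_univ i) (ind_of_not_mem hi), mul_zero]

/-- After moving a covered slot `a` to the head by the transposition `(0 a)`, the tail events' intersection lies in the head event. [this work] -/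
theorem iInter_tail_subset_of_covered {β : Type*} (B : ι → Set β) {k : ℕ} (s : Fin (k + 2) → ι) (a : Fin (k + 2))
    (ha : (⋂ b ∈ (univ : Finset (Fin (k + 2))).erase a, B (s b)) ⊆ B (s a)) :
    (⋂ i : Fin (k + 1), B (s (Equiv.swap 0 a i.succ))) ⊆ B (s (Equiv.swap 0 a 0)) := by
  rw [Equiv.swap_apply_left]
  refine Set.Subset.trans (fun x hx => ?_) ha
  simp only [Set.mem_iInter] at hx ⊢
  intro b hb
  have hb' : b ≠ a := (Finset.mem_erase.1 hb).1
  -- `b = swap 0 a (i.succ)` for `i = (swap 0 a b).pred _`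
  have hne : Equiv.swap 0 a b ≠ 0 := by
    intro h0
    have := congrArg (Equiv.swap (0 : Fin (k + 2)) a) h0
    rw [Equiv.swap_apply_self, Equiv.swap_apply_left] at this
    exact hb' this
  have := hx ((Equiv.swap 0 a b).pred hne)
  rwa [Fin.succ_pred, Equiv.swap_apply_self] at this

/-- **UNCOVERED REDUCTION (coin / mixture form).**  Let `B : ι → Set (α × Bool)` be any events on the coin space and `μ` a probability weight on `α`.  If for every
UNCOVERED slot map the cell `h ↦ E_m(μ ⊗ coin(h); 1_{B_{s 0}},…)` is Bernstein-positive of degree `m`, then it is for EVERY slot map.  (Generalises range lifting: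
a repeated slot is covered.)  Proof: strong induction on `m`; at a covered slot the top defect of P5's defect expansion vanishes
(`one_sub_ind_mul_prod_eq_zero`) and the remaining terms are products of coin moments of nonnegative functions with cells of proper sub-multisets. [this work] -/
theorem bernsteinPos_sahiE_of_uncovered {μ : α → ℝ} (hμ : ∀ a, 0 ≤ μ a) (hμ1 : ∑ a, μ a = 1) (B : ι → Set (α × Bool))
    (hunc : ∀ (m : ℕ) (s : Fin m → ι), Uncovered B s →
      BernsteinPos m (fun h => sahiE (coinWeight μ h) m (fun j => ind (B (s j))))) :
    ∀ (m : ℕ) (s : Fin m → ι), BernsteinPos m (fun h => sahiE (coinWeight μ h) m (fun j => ind (B (s j)))) := by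
  intro m
  induction m using Nat.strong_induction_on with
  | _ m ih =>
    intro s
    by_cases hs : Uncovered B s
    · exact hunc m s hs
    obtain ⟨a, ha⟩ : ∃ a, (⋂ b ∈ (univ : Finset (Fin m)).erase a, B (s b)) ⊆ B (s a) := by
      simpa [Uncovered] using hs
    -- `m ≥ 2`: for `m ≤ 1` the cells are Bernstein-positive outright
    rcases m with _ | _ | k
    · exact a.elim0
    · exact (bernsteinPos_ex_coinWeight hμ (fun x => ind_nonneg _ x)).congr fun h _ _ => by rw [sahiE_one_apply]
    set σ : Equiv.Perm (Fin (k + 2)) := Equiv.swap 0 a with hσ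
    set d : α × Bool → ℝ := ind (B (s (σ 0))) with hd
    set g : Fin (k + 1) → α × Bool → ℝ := fun i => ind (B (s (σ i.succ))) with hg
    have hperm : ∀ h : ℝ, sahiE (coinWeight μ h) (k + 2) (fun j => ind (B (s j)))
        = sahiE (coinWeight μ h) (k + 2) (Fin.cons d g : Fin (k + 2) → α × Bool → ℝ) := fun h => by
      rw [← sahiE_comp_perm (coinWeight μ h) (k + 2) σ (fun j => ind (B (s j)))]
      congr 1
      funext j
      refine Fin.cases ?_ (fun i => ?_) j
      · simp [hd]
      · simp [hg]
    have hg0 : ∀ i x, 0 ≤ g i x := fun i x => ind_nonneg _ _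
    have hd1 : ∀ x, d x ≤ 1 := fun x => ind_le_one _ _
    have hdef0 : ∀ (T : Finset (Fin (k + 1))) (x : α × Bool), 0 ≤ ((1 - d) * ∏ i ∈ T, g i) x := fun T x => by
      simp only [Pi.mul_apply, Pi.sub_apply, Pi.one_apply, Finset.prod_apply]
      exact mul_nonneg (sub_nonneg.2 (hd1 x)) (Finset.prod_nonneg fun i _ => hg0 i x)
    -- the top defect vanishes: the head contains the intersection of the tail
    have htop : ((1 - d) * ∏ i, g i) = 0 :=
      one_sub_ind_mul_prod_eq_zero (B (s (σ 0))) (fun i => B (s (σ i.succ))) (iInter_tail_subset_of_covered B s a ha)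
    have hsub : ∀ T : Finset (Fin (k + 1)), BernsteinPos Tᶜ.card
        (fun h => sahiE (coinWeight μ h) Tᶜ.card (fun j => g (Tᶜ.orderEmbOfFin rfl j))) := fun T => by
      have hlt : Tᶜ.card < k + 2 := lt_of_le_of_lt (Finset.card_le_univ _) (by simp)
      exact ih _ hlt (fun j => s (σ (Tᶜ.orderEmbOfFin rfl j).succ))
    have htail : BernsteinPos (k + 1) (fun h => sahiE (coinWeight μ h) (k + 1) g) :=
      ih _ (by omega) (fun i => s (σ i.succ))
    have hhead : BernsteinPos 1 (fun h => ((k : ℝ) + 1) - ex (coinWeight μ h) d) :=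
      bernsteinPos_const_sub_ex_coinWeight hμ hμ1 hd1 (by
        have : (0 : ℝ) ≤ k := Nat.cast_nonneg k
        linarith)
    have hterms : BernsteinPos (k + 2) (fun h =>
        ∑ T : Finset (Fin (k + 1)) with (T.Nonempty ∧ T ≠ univ),
          ((T.card)! : ℝ) * (ex (coinWeight μ h) ((1 - d) * ∏ i ∈ T, g i)
            * sahiE (coinWeight μ h) Tᶜ.card (fun j => g (Tᶜ.orderEmbOfFin rfl j)))) := by
      refine BernsteinPos.sum _ fun T hT => ?_
      have hcard : 1 + Tᶜ.card ≤ k + 2 := by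
        have h1 : Tᶜ.card ≤ k + 1 := (Finset.card_le_univ _).trans (by simp)
        omega
      exact ((bernsteinPos_ex_coinWeight hμ (hdef0 T)).mul_of_le (hsub T) hcard).smul (Nat.cast_nonneg _)
    have hall := ((hhead.mul_of_le htail (by omega)).add hterms)
    refine hall.congr fun h _ _ => ?_
    rw [hperm h, SahiDefectExpansion.sahiE_cons_eq_defect_expansion (coinWeight μ h) k d g, htop]
    simp [ex_def]

/-- **UNCOVERED REDUCTION at a fixed weight**: nonnegativity of every row from the uncovered rows (any events `B : ι → Set β`, any probability weight). [this work] -/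
theorem sahiE_nonneg_of_uncovered {β : Type*} [Fintype β] {ν : β → ℝ} (hν : ∀ x, 0 ≤ ν x) (hν1 : ∑ x, ν x = 1) (B : ι → Set β)
    (hunc : ∀ (m : ℕ) (s : Fin m → ι), Uncovered B s → 0 ≤ sahiE ν m (fun j => ind (B (s j)))) :
    ∀ (m : ℕ) (s : Fin m → ι), 0 ≤ sahiE ν m (fun j => ind (B (s j))) := by
  intro m
  induction m using Nat.strong_induction_on with
  | _ m ih =>
    intro s
    by_cases hs : Uncovered B s
    · exact hunc m s hs
    obtain ⟨a, ha⟩ : ∃ a, (⋂ b ∈ (univ : Finset (Fin m)).erase a, B (s b)) ⊆ B (s a) := by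
      simpa [Uncovered] using hs
    rcases m with _ | _ | k
    · exact a.elim0
    · rw [sahiE_one_apply]; exact ex_nonneg hν fun x => ind_nonneg _ x
    set σ : Equiv.Perm (Fin (k + 2)) := Equiv.swap 0 a with hσ
    set d : β → ℝ := ind (B (s (σ 0))) with hd
    set g : Fin (k + 1) → β → ℝ := fun i => ind (B (s (σ i.succ))) with hg
    have hperm : sahiE ν (k + 2) (fun j => ind (B (s j))) = sahiE ν (k + 2) (Fin.cons d g : Fin (k + 2) → β → ℝ) := by
      rw [← sahiE_comp_perm ν (k + 2) σ (fun j => ind (B (s j)))]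
      congr 1
      funext j
      refine Fin.cases ?_ (fun i => ?_) j
      · simp [hd]
      · simp [hg]
    have hg0 : ∀ i x, 0 ≤ g i x := fun i x => ind_nonneg _ _
    have hd1 : ∀ x, d x ≤ 1 := fun x => ind_le_one _ _
    have htop : ((1 - d) * ∏ i, g i) = 0 :=
      one_sub_ind_mul_prod_eq_zero (B (s (σ 0))) (fun i => B (s (σ i.succ))) (iInter_tail_subset_of_covered B s a ha)
    have hsub : ∀ T : Finset (Fin (k + 1)), 0 ≤ sahiE ν Tᶜ.card (fun j => g (Tᶜ.orderEmbOfFin rfl j)) := fun T => by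
      have hlt : Tᶜ.card < k + 2 := lt_of_le_of_lt (Finset.card_le_univ _) (by simp)
      exact ih _ hlt (fun j => s (σ (Tᶜ.orderEmbOfFin rfl j).succ))
    have htail : 0 ≤ sahiE ν (k + 1) g := ih _ (by omega) (fun i => s (σ i.succ))
    have hhead : 0 ≤ ((k : ℝ) + 1) - ex ν d := by
      have hle : ex ν d ≤ 1 := (ex_mono hν hd1).trans_eq (ex_const hν1 1)
      have : (0 : ℝ) ≤ k := Nat.cast_nonneg k
      linarith
    rw [hperm, SahiDefectExpansion.sahiE_cons_eq_defect_expansion ν k d g, htop]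
    simp only [ex_def, Pi.zero_apply, mul_zero, Finset.sum_const_zero, sub_zero]
    refine add_nonneg (mul_nonneg hhead htail) (Finset.sum_nonneg fun T _ => mul_nonneg (Nat.cast_nonneg _) (mul_nonneg ?_ (hsub T)))
    exact Finset.sum_nonneg fun x _ => mul_nonneg (hν x) (by
      simp only [Pi.mul_apply, Pi.sub_apply, Pi.one_apply, Finset.prod_apply]
      exact mul_nonneg (sub_nonneg.2 (hd1 x)) (Finset.prod_nonneg fun i _ => hg0 i x))

end Coin

/-! ### Intersection-closed families: uncovered ⇒ irredundant ⇒ at most `n` slots -/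

section Irredundant

variable {n : ℕ}

/-- A family of index sets is IRREDUNDANT if no member lies in the union of the others (each keeps a private element). [this work] -/
def Irredundant {m : ℕ} (K : Fin m → Finset (Fin n)) : Prop :=
  ∀ a : Fin m, ¬ (K a ⊆ ((univ : Finset (Fin m)).erase a).biUnion K)

/-- For an intersection-closed family `B_K = ⋂_{i∈K} E_i`, an uncovered slot map is irredundant. [this work] -/
theorem Irredundant.of_uncovered {β : Type*} (E : Fin n → Set β) {m : ℕ} (K : Fin m → Finset (Fin n))
    (h : Uncovered (fun L : Finset (Fin n) => ⋂ i ∈ L, E i) K) : Irredundant K := by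
  intro a ha
  refine h a fun x hx => ?_
  simp only [Set.mem_iInter] at hx ⊢
  intro i hi
  obtain ⟨b, hb, hib⟩ := Finset.mem_biUnion.1 (ha hi)
  exact hx b hb i hib

/-- An irredundant family of subsets of `Fin n` has at most `n` members (private elements are distinct). [this work] -/
theorem Irredundant.card_le {m : ℕ} {K : Fin m → Finset (Fin n)} (h : Irredundant K) : m ≤ n := by
  have hex : ∀ a : Fin m, ∃ i : Fin n, i ∈ K a ∧ i ∉ ((univ : Finset (Fin m)).erase a).biUnion K := fun a => by
    simpa [Finset.subset_iff] using h a
  choose f hf using hex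
  have hinj : Injective f := by
    intro a b hab
    by_contra hne
    have : f a ∈ ((univ : Finset (Fin m)).erase a).biUnion K :=
      Finset.mem_biUnion.2 ⟨b, Finset.mem_erase.2 ⟨Ne.symm hne, Finset.mem_univ b⟩, hab ▸ (hf b).1⟩
    exact (hf a).2 this
  simpa using Fintype.card_le_of_injective f hinj

variable {α : Type*} [Fintype α] {μ : α → ℝ}

/-- **`𝒦`-membership is decided by the irredundant rows (order `≤ n`).**  If every IRREDUNDANT row `E_m(μ; 1_{A_{K_0}},…,1_{A_{K_{m−1}}})` (necessarily `m ≤ n`) of the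
∩-closed family is `≥ 0`, the family is hereditarily all-orders positive. [this work] -/
theorem hereditaryAllOrders_of_irredundant (hμ : ∀ a, 0 ≤ μ a) (hμ1 : ∑ a, μ a = 1) (A : Fin n → Set α)
    (hirr : ∀ (m : ℕ) (K : Fin m → Finset (Fin n)), Irredundant K → 0 ≤ sahiE μ m (fun j => ind (⋂ i ∈ K j, A i))) :
    HereditaryAllOrders μ A :=
  fun m K => sahiE_nonneg_of_uncovered hμ hμ1 (fun L : Finset (Fin n) => ⋂ i ∈ L, A i)
    (fun m' K' hK' => hirr m' K' (Irredundant.of_uncovered A K' hK')) m K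

/-- **The hereditary mixture statement for `n` events follows from its irredundant cells (`m ≤ n` slots).**  For the OR-mixed events `E_i = A_i ∪ [F i]·H` on the
coin space: if every irredundant cell `h ↦ E_m(μ⊗coin(h); (1_{⋂_{i∈K_j} E_i})_j)` is Bernstein-positive of degree `m`, then all cells are. [this work] -/
theorem hereditaryMixture_of_irredundant (hμ : ∀ a, 0 ≤ μ a) (hμ1 : ∑ a, μ a = 1) (A : Fin n → Set α) (F : Fin n → Bool)
    (hirr : ∀ (m : ℕ) (K : Fin m → Finset (Fin n)), Irredundant K →
      BernsteinPos m (fun h => sahiE (coinWeight μ h) m (fun j => ind (⋂ i ∈ K j, orCoin (A i) (F i))))) :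
    ∀ (m : ℕ) (K : Fin m → Finset (Fin n)),
      BernsteinPos m (fun h => sahiE (coinWeight μ h) m (fun j => ind (⋂ i ∈ K j, orCoin (A i) (F i)))) :=
  fun m K => bernsteinPos_sahiE_of_uncovered hμ hμ1 (fun L : Finset (Fin n) => ⋂ i ∈ L, orCoin (A i) (F i))
    (fun m' K' hK' => hirr m' K' (Irredundant.of_uncovered _ K' hK')) m K

/-- Hence H-MIX is equivalent to its irredundant cells: a finite list of `m ≤ n` slot statements per `(n, F)`. [this work] -/
theorem hereditaryMixturePositivity_iff_irredundant :
    HereditaryMixturePositivity ↔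
      ∀ (α : Type) [Fintype α] (μ : α → ℝ), (∀ a, 0 ≤ μ a) → ∑ a, μ a = 1 →
        ∀ (n : ℕ) (A : Fin n → Set α) (F : Fin n → Bool), HereditaryAllOrders μ A →
          ∀ (m : ℕ) (K : Fin m → Finset (Fin n)), Irredundant K → m ≤ n ∧
            BernsteinPos m (fun h => sahiE (coinWeight μ h) m (fun j => ind (⋂ i ∈ K j, orCoin (A i) (F i)))) := by
  constructor
  · intro hmix α _ μ hμ hμ1 n A F hA m K hK
    exact ⟨hK.card_le, hmix α μ hμ hμ1 n A F hA m K⟩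
  · intro h α _ μ hμ hμ1 n A F hA m K
    exact hereditaryMixture_of_irredundant hμ hμ1 A F (fun m' K' hK' => (h α μ hμ hμ1 n A F hA m' K' hK').2) m K

end Irredundant

end SahiMixture

end Summit.CriticalPhenomena.PercolationContinuityZ3.Theorems

end
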